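import Summits.BirchSwinnertonDyer.BirchSwinnertonDyer.Theorems.AdditiveKolyvaginRoadKolyvaginPerfLocal
import Summits.BirchSwinnertonDyer.BirchSwinnertonDyer.Theorems.AdditiveKolyvaginRoadKolyvaginPerfCore
import Summits.BirchSwinnertonDyer.BirchSwinnertonDyer.Theorems.AdditiveKolyvaginRoadKolyvaginGrossBridge
import Summits.BirchSwinnertonDyer.BirchSwinnertonDyer.Theorems.AdditiveKolyvaginRoadLocalDictionaries
import Summits.BirchSwinnertonDyer.BirchSwinnertonDyer.Theorems.KolyvaginRoadThreeMethod2KolyvaginPerf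
import HarnessLib

/-!
# Route `AdditiveKolyvaginRoad`, crux `KolyvaginPrimitiveAdditive` (item stmt-BirchSwinnertonDyer-20132):
# stub LOC, input (Perf) at a GENERAL odd prime `p` — THE LOCAL WEIL CUP PRODUCT PAIRS THE UNRAMIFIED AND THE TRANSVERSE
# EIGEN-LINES AT A KOLYVAGIN PRIME NON-DEGENERATELY
# (cell `pub/bsd-wall`, lead prover `bsd-wall-akr-p1` g3; `--supports stmt-BirchSwinnertonDyer-20132`, helper;
# p-generic port of zhang3-p1's `Theorems/KolyvaginRoadThreeMethod2KolyvaginPerf.lean`, `3 ↦ p¹`)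

WHY THIS FILE. Stub LOC of skeleton v8 of crux 20132 is reduced to (Perf) + (Supply)
(`kolyvaginLocalPackageP_of_perf_of_supply`). This file DISCHARGES (Perf) at every odd prime `p` with `ρ̄_{E,p}` onto:
after its frame arguments `cupProduct_ne_zero_of_selmer_of_transverse_P` is the binder `hperf`'s body per Kolyvagin prime
and place (W. Zhang Lemma 8.4 (1)/(3) with Gross Prop. 8.1–8.2). Proof = zhang3-p1's STRUCTURAL argument verbatim with
`3 ↦ p¹`: `Γ_λ` acts trivially on `E[p]` (bsd-jet) and on `μ_p` (`…PerfLocal`), so local `1`-cocycles are homomorphisms;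
the cocycle of `loc x` is `σ ↦ k_σ P` with `P = [x, F] ≠ 0` (Gross's Frobenius lift, Prop. 9.6); by local Tate duality
(the perfect Poitou–Tate family) some class pairs non-trivially with `loc x`; the character identity on `Γ_λ`
(`exists_sub_zsmul_eq_nsmul_P`: tame factorisation, `n` ramified by transversality + `G_𝔓 = I·Stab K[ℓ]` + Gross
Prop. 8.1 (1) + opposite eigenvectors pair non-trivially) and the rank-one cocycle lemma
(`twoCocycleClass_ne_zero_of_rank_one_P`) transfer the non-vanishing to `loc x ∪ₑ loc y`.

WHAT. `exists_frob_inertia_weil_ne_zero_P` (the ramified value) and `cupProduct_ne_zero_of_selmer_of_transverse_P` ((Perf)).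

HONEST FRAMING: theorems only; 0 definitions, 0 named facts, 0 `sorry`; closes nothing by itself (with `…PerfSupply`, stub
LOC reduces to (Supply) alone).

References: [cite: WZhang2014, Lemma 8.4 (1), (3), §8.1] [cite: GrossLMS1991, Prop. 8.1, Prop. 8.2, Prop. 9.6]
[cite: MilneADT2006, Ch. I, Cor. 2.3] [cite: MazurRubin2004, Prop. 1.3.2].
-/

-- single-conjunct summit: `Summit.BirchSwinnertonDyer.BirchSwinnertonDyer.…` repeats the name by design
set_option linter.dupNamespace false

noncomputable section

open scoped Classical Pointwise

namespace Summit.BirchSwinnertonDyer.BirchSwinnertonDyer.Theorems.AdditiveKoly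

open CategoryTheory WeierstrassCurve Field Function NumberField IsDedekindDomain
open Literature.NumberTheory.EllipticCurves Literature.NumberTheory.EllipticCurves.ModularForms
  Literature.NumberTheory.GaloisRepresentations Module
open Literature.NumberTheory.GaloisRepresentations.DiscreteGaloisModule (mu MuCarrier tateDual tateDualEval TateDual)
open Literature.NumberTheory.GaloisCohomology
open Summit.BirchSwinnertonDyer.Rank1Residual.X11b.Three.Koly.Method2
open Summit.BirchSwinnertonDyer.Rank1Residual.GaloisImage
open Summit.BirchSwinnertonDyer.Rank1Residual.JET Summit.BirchSwinnertonDyer.Rank1Residual.X11b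
open scoped ContRepresentation

variable (W : WeierstrassCurve ℚ) (K : Type) [Field K] [NumberField K] (p : ℕ) [W.IsElliptic] [W.IsGloballyMinimal]
  [Fact p.Prime] [∀ v : Place K, CompactSpace (absoluteGaloisGroup (Place.Completion v))]
  [Finite (geomTorsion (W.baseChange K) ((p ^ 1 : ℕ) : ℤ))]

omit [∀ v : Place K, CompactSpace (absoluteGaloisGroup (Place.Completion v))]
  [Finite (geomTorsion (W.baseChange K) ((p ^ 1 : ℕ) : ℤ))] in
/-- **The ramified value at a Kolyvagin prime** (Gross 1991, Prop. 8.1 (1)–(2) + Prop. 9.6, for the classes of (Perf)):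
for `x ∈ H¹(K, E[p])^{s}` Selmer at `λ` with `loc_λ x ≠ 0` and `y ∈ H¹(K, E[p])^{s}` transverse at `λ` with `loc_λ y ≠ 0`,
there are an arithmetic Frobenius `F ∈ Γ_{K(E[p])}` at the prime `𝔓 ∣ λ` cut out by the chosen embedding and an inertia
element `i ∈ I_𝔓` with `P = [x, F] ≠ 0` and `e(P, [y, i]) ≠ 1` (additively: `≠ 0` in `μ_p`). Proof: Gross's Frobenius lift
(`exists_frobeniusLift_of_isKolyvaginPrime`, through the bridge `isKolyvaginPrime_three_of_zhang`); `P ≠ 0` by Prop. 9.6;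
`P ∈ E[p]^{s}`; `y ∉ torsionLocalKer` gives `d ∈ G_𝔓` with `[y, d] ≠ 0`, `G_𝔓 = I_𝔓 (G_𝔓 ∩ Stab K[ℓ])` and transversality
give `i ∈ I_𝔓` with `[y, i] ≠ 0`, `[y, i] ∈ E[p]^{-s}` (Prop. 8.1 (1)), and opposite eigenvectors pair non-trivially.
[cite: GrossLMS1991, Prop. 8.1, Prop. 8.2 (proof), Prop. 9.6] [cite: WZhang2014, §8.1] -/
theorem exists_frob_inertia_weil_ne_zero_P (hK : IsImaginaryQuadratic K) (hp2 : p ≠ 2) (hsurj : W.HasSurjectiveModNGaloisRep p)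
    (ι : K →+* ℂ) {c : K ≃ₐ[ℚ] K} (hc : c ≠ 1)
    (e : geomTorsion (W.baseChange K) ((p ^ 1 : ℕ) : ℤ) → geomTorsion (W.baseChange K) ((p ^ 1 : ℕ) : ℤ) →
      AlgebraicClosure K)
    (hμ : ∀ P Q, e P Q ^ (p ^ 1) = 1) (hadd₁ : ∀ P₁ P₂ Q, e (P₁ + P₂) Q = e P₁ Q * e P₂ Q)
    (hadd₂ : ∀ P Q₁ Q₂, e P (Q₁ + Q₂) = e P Q₁ * e P Q₂) (halt : ∀ Q, e Q Q = 1)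
    (hnondeg : ∀ Q, (∀ P, e P Q = 1) → Q = 0)
    {ℓ : ℕ} (hℓ : Zhang2014.IsKolyvaginPrime (W.conductorNorm ℤ) W K p ℓ) (v : HeightOneSpectrum (𝓞 K))
    (hv : (ℓ : 𝓞 K) ∈ v.asIdeal) {𝔐 : Ideal (HeightOneSpectrum.localAbsIntegers v)} (h𝔐 : 𝔐 ∈ v.localPrimesAbove)
    (s : Bool) {x y : Vp W K p}
    (hxs : conjAct W c ((p ^ 1 : ℕ) : ℤ) x = sgnP s • x) (hys : conjAct W c ((p ^ 1 : ℕ) : ℤ) y = sgnP s • y)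
    (hxK : x ∈ selmerLocalKer (W.baseChange K) (v.adicCompletion K) ((p ^ 1 : ℕ) : ℤ))
    (hx0 : x ∉ (W.baseChange K).torsionLocalKer (v.adicCompletion K) ((p ^ 1 : ℕ) : ℤ))
    (hyT : y ∈ transverseLocalKerP W K p ι ℓ v)
    (hy0 : y ∉ (W.baseChange K).torsionLocalKer (v.adicCompletion K) ((p ^ 1 : ℕ) : ℤ)) :
    ∃ F i : absoluteGaloisGroup K,
      IsArithFrobAt (𝓞 K) F (v.primeBelow (closureEmb (K := K) (v.adicCompletion K)) 𝔐) ∧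
      F ∈ torsionFixing (W.baseChange K) ((p ^ 1 : ℕ) : ℤ) ∧
      i ∈ (v.primeBelow (closureEmb (K := K) (v.adicCompletion K)) 𝔐).inertia (absoluteGaloisGroup K) ∧
      h1Eval (W.baseChange K) ((p ^ 1 : ℕ) : ℤ) x F ≠ 0 ∧
      weilPairingHom (W.baseChange K) (p ^ 1) e hμ hadd₁ hadd₂ (h1Eval (W.baseChange K) ((p ^ 1 : ℕ) : ℤ) x F)
        (h1Eval (W.baseChange K) ((p ^ 1 : ℕ) : ℤ) y i) ≠ 0 := by
  classical
  have hp : p.Prime := Fact.out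
  have hp1 : Nat.Prime (p ^ 1) := by rw [pow_one]; exact hp
  have hp12 : p ^ 1 ≠ 2 := by rw [pow_one]; exact hp2
  have hpZ : ((p ^ 1 : ℕ) : ℤ) ≠ 0 := by exact_mod_cast hp1.ne_zero
  have hk1 : 1 ≤ Zhang2014.kolyvaginIndex W p ℓ := hℓ.2.2.2.2.2
  haveI : NeZero (p ^ 1 : ℕ) := ⟨pow_ne_zero 1 hp.ne_zero⟩
  -- ### the Kolyvagin prime in Gross's sense (at level `p ^ 1`); `v = λ`; good reduction, `p ∉ λ`
  have hℓG : IsKolyvaginPrime (W.conductorNorm ℤ) W K (p ^ 1) ℓ := isKolyvaginPrime_pow_one_of_zhang W K p hK hp2 hsurj hℓ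
  have hvw : v = hℓG.place := hℓG.mem_iff.mp hv
  subst hvw
  obtain ⟨hgood, h3v⟩ := GlobalDuality.hasGoodReductionAt_of_zhangKolyvaginPrime W K hℓ hℓG.place hv 1
  have hvbad : hℓG.place ∉ (W.baseChange K).badPlaces (𝓞 K) := fun h ↦ h hgood
  haveI : CharZero (hℓG.place.adicCompletion K) :=
    charZero_of_injective_algebraMap (algebraMap K (hℓG.place.adicCompletion K)).injective
  set Kv := hℓG.place.adicCompletion K with hKv
  have h𝔓 : hℓG.place.primeBelow (closureEmb (K := K) Kv) 𝔐 ∈ hℓG.place.primesAbove :=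
    HeightOneSpectrum.primeBelow_mem_primesAbove h𝔐
  -- ### Gross's Frobenius lift at `𝔓`
  obtain ⟨h, c₀, F, ht, -, -, hμinv, hFrob, hF, -, hFT, hcF, -, -, -, -⟩ :=
    exists_frobeniusLift_of_isKolyvaginPrime W hK (p := p ^ 1) hp1 hp12 hc hℓG h𝔓
  have hI : (hℓG.place.primeBelow (closureEmb (K := K) Kv) 𝔐).inertia (absoluteGaloisGroup K) ≤
      torsionFixing (W.baseChange K) ((p ^ 1 : ℕ) : ℤ) := inertia_le_torsionFixing (W.baseChange K) hvbad h3v _ h𝔐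
  have hD : ∀ d ∈ (hℓG.place.primeBelow (closureEmb (K := K) Kv) 𝔐).decompositionSubgroup (absoluteGaloisGroup K),
      d ∈ torsionFixing (W.baseChange K) ((p ^ 1 : ℕ) : ℤ) := fun d hd ↦
    GlobalDuality.decompositionSubgroup_le_torsionFixing W K hK hℓ hk1 hℓG.place hv h𝔓 hd
  -- ### `P = [x, F] ∈ E[p]^{s} ∖ 0`
  have hxunr : x ∈ unramifiedKer (geomTorsion (W.baseChange K) ((p ^ 1 : ℕ) : ℤ))
      (hℓG.place.primeBelow (closureEmb (K := K) Kv) 𝔐) := by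
    rw [← (W.baseChange K).selmerLocalKer_eq_unramifiedKer hgood h3v h𝔓]; exact hxK
  have hP0 : h1Eval (W.baseChange K) ((p ^ 1 : ℕ) : ℤ) x F ≠ 0 := fun h0 ↦ hx0
    ((mem_torsionLocalKer_iff_h1Eval_eq_zero (W.baseChange K) ((p ^ 1 : ℕ) : ℤ) h𝔐 hF hFT hI
      (isOpen_torsionFixing (W.baseChange K) hpZ)
      (torsionPointsMap_bijective (W.baseChange K) Kv (n := p ^ 1) hp1.ne_zero).2 hxunr).mpr h0)
  have hPs : ht.torsionMap W ((p ^ 1 : ℕ) : ℤ) (h1Eval (W.baseChange K) ((p ^ 1 : ℕ) : ℤ) x F) =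
      sgnP s • h1Eval (W.baseChange K) ((p ^ 1 : ℕ) : ℤ) x F := torsionMap_h1Eval_eq_of_conjAct_eq W ht _ hFT hcF hxs
  have hν : sgnP s = 1 ∨ sgnP s = -1 := by cases s <;> simp [sgnP]
  -- ### a decomposition element, then an inertia element, with non-zero `y`-value
  set φy := reprCocycle (W.baseChange K) ((p ^ 1 : ℕ) : ℤ) y with hφy
  have hyD : ∃ d ∈ (hℓG.place.primeBelow (closureEmb (K := K) Kv) 𝔐).decompositionSubgroup (absoluteGaloisGroup K),
      φy.1 d ≠ 0 := by
    by_contra hall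
    push Not at hall
    apply hy0
    rw [← oneCocycleClass_reprCocycle (W.baseChange K) ((p ^ 1 : ℕ) : ℤ) y]
    exact (LocalFrob.oneCocycleClass_mem_torsionLocalKer_iff (W.baseChange K) (v := hℓG.place) (n := p ^ 1)
      (pow_ne_zero 1 hp.ne_zero) h𝔐 φy).mpr ⟨0, fun d hd ↦ by rw [hall d hd, smul_zero, sub_zero]⟩
  obtain ⟨d, hdD, hd0⟩ := hyD
  obtain ⟨i, hiI, hi'⟩ := exists_inertia_inv_mul_mem_ringClassStabilizer_P W K p hK ι hℓ hℓG.place hv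
    (fun v' ↦ hℓG.mem_iff) h𝔓 hdD
  have hiD : i ∈ (hℓG.place.primeBelow (closureEmb (K := K) Kv) 𝔐).decompositionSubgroup (absoluteGaloisGroup K) :=
    Ideal.inertia_le_stabilizer _ hiI
  have hQ0 : φy.1 i ≠ 0 := by
    intro h0
    apply hd0
    have hd' : i⁻¹ * d ∈ (hℓG.place.primeBelow (closureEmb (K := K) Kv) 𝔐).decompositionSubgroup (absoluteGaloisGroup K) :=
      Subgroup.mul_mem _ (Subgroup.inv_mem _ hiD) hdD
    have htr : φy.1 (i⁻¹ * d) = 0 := (mem_transverseLocalKerP_iff.mp hyT) _ h𝔓 _ hd' hi' (hD _ hd')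
    have hsplit := φy.2 i (i⁻¹ * d)
    rw [mul_inv_cancel_left] at hsplit
    rw [hsplit, htr, map_zero, add_zero]
    exact h0
  -- `[y, i] ∈ E[p]^{-s}` (Gross Prop. 8.1 (1)), hence `e(P, [y, i]) ≠ 1`
  have hQs : ht.torsionMap W ((p ^ 1 : ℕ) : ℤ) (φy.1 i) = -(sgnP s • φy.1 i) :=
    torsionMap_h1Eval_inertia_eq_neg W (p := p ^ 1) hp1 hℓG hvbad h𝔓 ht hFrob hμinv hys hiI
  have hePQ : e (h1Eval (W.baseChange K) ((p ^ 1 : ℕ) : ℤ) x F) (φy.1 i) ≠ 1 :=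
    weil_ne_one_of_eigen_P W K p hp2 e hμ hadd₁ hadd₂ halt hnondeg (ht.torsionMap W _) hν hPs hP0 hQs hQ0
  refine ⟨F, i, hF, hFT, hiI, hP0, fun h0 ↦ hePQ ?_⟩
  rw [muCarrier_eq_iff, coe_weilPairingHom] at h0
  exact h0

set_option maxHeartbeats 800000 in
/-- **(Perf) at a Kolyvagin prime of the HL frame** — binder `hperf` of `Method2.triangulation_of_kolyvaginLocal`, per prime
and per place `v ∋ ℓ`: for every Weil-type pairing `e` on `E[p]` and each sign `s`, the local Weil cup product of the
`λ`-localisations of `x ∈ H¹(K, E[p])^{s}` Selmer at `λ` with `loc_λ x ≠ 0` and `y ∈ H¹(K, E[p])^{s}` transverse at `λ` with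
`loc_λ y ≠ 0` is non-zero. See the module docstring for the (structural) proof.
[cite: WZhang2014, Lemma 8.4 (1), (3), §8.1] [cite: GrossLMS1991, Prop. 8.1, Prop. 8.2, Prop. 9.6]
[cite: MilneADT2006, Ch. I, Cor. 2.3] -/
theorem cupProduct_ne_zero_of_selmer_of_transverse_P (hK : IsImaginaryQuadratic K) (hp2 : p ≠ 2) (hsurj : W.HasSurjectiveModNGaloisRep p)
    (ι : K →+* ℂ) {c : K ≃ₐ[ℚ] K} (hc : c ≠ 1)
    (e : geomTorsion (W.baseChange K) ((p ^ 1 : ℕ) : ℤ) → geomTorsion (W.baseChange K) ((p ^ 1 : ℕ) : ℤ) →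
      AlgebraicClosure K)
    (hμ : ∀ P Q, e P Q ^ (p ^ 1) = 1) (hadd₁ : ∀ P₁ P₂ Q, e (P₁ + P₂) Q = e P₁ Q * e P₂ Q)
    (hadd₂ : ∀ P Q₁ Q₂, e P (Q₁ + Q₂) = e P Q₁ * e P Q₂) (halt : ∀ Q, e Q Q = 1)
    (hnondeg : ∀ Q, (∀ P, e P Q = 1) → Q = 0)
    (hgal : ∀ (σ : absoluteGaloisGroup K) (P Q : geomTorsion (W.baseChange K) ((p ^ 1 : ℕ) : ℤ)),
      σ • e P Q = e (σ • P) (σ • Q))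
    {ℓ : ℕ} (hℓ : Zhang2014.IsKolyvaginPrime (W.conductorNorm ℤ) W K p ℓ) (v : HeightOneSpectrum (𝓞 K))
    (hv : (ℓ : 𝓞 K) ∈ v.asIdeal) (s : Bool) {x y : Vp W K p}
    (hxs : conjAct W c ((p ^ 1 : ℕ) : ℤ) x = sgnP s • x) (hys : conjAct W c ((p ^ 1 : ℕ) : ℤ) y = sgnP s • y)
    (hxK : x ∈ selmerLocalKer (W.baseChange K) (v.adicCompletion K) ((p ^ 1 : ℕ) : ℤ))
    (hx0 : x ∉ (W.baseChange K).torsionLocalKer (v.adicCompletion K) ((p ^ 1 : ℕ) : ℤ))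
    (hyT : y ∈ transverseLocalKerP W K p ι ℓ v)
    (hy0 : y ∉ (W.baseChange K).torsionLocalKer (v.adicCompletion K) ((p ^ 1 : ℕ) : ℤ)) :
    (weilContPairingLocal (W.baseChange K) (p ^ 1) e hμ hadd₁ hadd₂ hgal (Sum.inr v)).cupProduct
      (galoisCohomology.localization ((W.baseChange K).torsionGaloisModule ((p ^ 1 : ℕ) : ℤ)) (Sum.inr v) 1 x)
      (galoisCohomology.localization ((W.baseChange K).torsionGaloisModule ((p ^ 1 : ℕ) : ℤ)) (Sum.inr v) 1 y) ≠ 0 := by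
  classical
  have hp : p.Prime := Fact.out
  have hp1 : Nat.Prime (p ^ 1) := by rw [pow_one]; exact hp
  have hp12 : p ^ 1 ≠ 2 := by rw [pow_one]; exact hp2
  have hpZ : ((p ^ 1 : ℕ) : ℤ) ≠ 0 := by exact_mod_cast hp1.ne_zero
  have hk1 : 1 ≤ Zhang2014.kolyvaginIndex W p ℓ := hℓ.2.2.2.2.2
  haveI : NeZero (p ^ 1 : ℕ) := ⟨pow_ne_zero 1 hp.ne_zero⟩
  haveI : IsTotallyComplex K := hK.2
  -- the perfect Poitou–Tate family of the tree (local Tate duality at `λ`)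
  obtain ⟨inv, hinvperf, -⟩ := poitouTate_sum_localTatePairing_eq_zero_of_isTotallyComplex K (p ^ 1)
  -- ### the Kolyvagin prime in Gross's sense; `v = λ`; `3 ∉ λ`
  have hℓG := isKolyvaginPrime_pow_one_of_zhang W K p hK hp2 hsurj hℓ
  have hvw : v = hℓG.place := hℓG.mem_iff.mp hv
  subst hvw
  obtain ⟨hgood, h3v⟩ := GlobalDuality.hasGoodReductionAt_of_zhangKolyvaginPrime W K hℓ hℓG.place hv 1
  obtain ⟨𝔐, h𝔐⟩ := hℓG.place.localPrimesAbove_nonempty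
  have h𝔓 : hℓG.place.primeBelow (closureEmb (K := K) (hℓG.place.adicCompletion K)) 𝔐 ∈ hℓG.place.primesAbove :=
    HeightOneSpectrum.primeBelow_mem_primesAbove h𝔐
  haveI := h𝔓.1
  -- ### the ramified value (Gross's Frobenius `F`, the inertia element `i`)
  obtain ⟨F, i, hF, hFT, hiI, hP0, hW₀Q⟩ := exists_frob_inertia_weil_ne_zero_P W K p hK hp2 hsurj ι hc e hμ hadd₁ hadd₂ halt hnondeg
    hℓ hℓG.place hv h𝔐 s hxs hys hxK hx0 hyT hy0
  have hD : ∀ d ∈ (hℓG.place.primeBelow (closureEmb (K := K) (hℓG.place.adicCompletion K)) 𝔐).decompositionSubgroup (absoluteGaloisGroup K),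
      d ∈ torsionFixing (W.baseChange K) ((p ^ 1 : ℕ) : ℤ) := fun d hd ↦
    GlobalDuality.decompositionSubgroup_le_torsionFixing W K hK hℓ hk1 hℓG.place hv h𝔓 hd
  have hres : ∀ g : absoluteGaloisGroup (hℓG.place.adicCompletion K), absGaloisRestrict K (hℓG.place.adicCompletion K) g ∈
      (hℓG.place.primeBelow (closureEmb (K := K) (hℓG.place.adicCompletion K)) 𝔐).decompositionSubgroup (absoluteGaloisGroup K) := fun g ↦ by
    rw [← resGal_eq_absGaloisRestrict, resGal_eq]; exact resGalOfEmb_mem_decompositionSubgroup _ h𝔐 g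
  have hfixA : ∀ (g : absoluteGaloisGroup (hℓG.place.adicCompletion K)) (Q : geomTorsion (W.baseChange K) ((p ^ 1 : ℕ) : ℤ)),
      absGaloisRestrict K (hℓG.place.adicCompletion K) g • Q = Q := fun g Q ↦ smul_eq_of_mem_torsionFixing (W.baseChange K) _ (hD _ (hres g)) Q
  have hfixμ : ∀ (g : absoluteGaloisGroup (hℓG.place.adicCompletion K)) (z : MuCarrier K (p ^ 1)), mu K (p ^ 1) (absGaloisRestrict K (hℓG.place.adicCompletion K) g) z = z := by
    intro g z
    apply MuCarrier.toAdditive.injective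
    rw [DiscreteGaloisModule.mu_apply_apply]
    apply Additive.toMul.injective
    rw [toMul_ofMul]
    apply Subtype.ext
    apply Units.ext
    rw [absoluteGaloisGroup.coe_smul_rootsOfUnity, Units.coe_smul]
    have hz : ((((MuCarrier.toAdditive z).toMul : rootsOfUnity (p ^ 1) (AlgebraicClosure K)) : (AlgebraicClosure K)ˣ) :
        AlgebraicClosure K) ^ p = 1 := by
      have h1 := ((MuCarrier.toAdditive z).toMul).2
      rw [mem_rootsOfUnity] at h1
      have h1' : ((MuCarrier.toAdditive z).toMul : rootsOfUnity (p ^ 1) (AlgebraicClosure K)).1 ^ p = 1 :=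
        (congrArg (fun k : ℕ ↦ ((MuCarrier.toAdditive z).toMul : rootsOfUnity (p ^ 1) (AlgebraicClosure K)).1 ^ k)
          (pow_one p)).symm.trans h1
      rw [← Units.val_pow_eq_pow_val, h1', Units.val_one]
    exact smul_eq_self_of_pow_eq_one_of_mem_torsionFixing_P W K p e hμ hnondeg hgal (hD _ (hres g)) hz
  obtain ⟨gF, hgF⟩ := KolyLocal.exists_absGaloisRestrict_eq_of_mem_decompositionSubgroup K hℓG.place h𝔐 hF.mem_stabilizer
  have hpT : ∀ Q : geomTorsion (W.baseChange K) ((p ^ 1 : ℕ) : ℤ), p • Q = 0 := fun Q ↦ by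
    have := (mem_geomTorsion_iff (W.baseChange K) ((p ^ 1 : ℕ) : ℤ) _).mp Q.2
    apply Subtype.ext
    rw [AddSubgroupClass.coe_nsmul, ← natCast_zsmul]
    simpa using this
  have hμ3 : ∀ z : MuCarrier K (p ^ 1), p • z = 0 := fun z ↦ by
    rw [← show (p ^ 1) • z = p • z from congrArg (fun k : ℕ ↦ k • z) (pow_one p), ← natCast_zsmul]
    exact zsmul_muCarrier_eq_zero K (p ^ 1) z
  -- ### the cocycles (global representatives `φx, φy`; local pullbacks `fx, fy` on `Γ_λ`)
  obtain ⟨φx, hφx⟩ : ∃ φ, φ = reprCocycle (W.baseChange K) ((p ^ 1 : ℕ) : ℤ) x := ⟨_, rfl⟩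
  obtain ⟨φy, hφy⟩ : ∃ φ, φ = reprCocycle (W.baseChange K) ((p ^ 1 : ℕ) : ℤ) y := ⟨_, rfl⟩
  have hPφ : h1Eval (W.baseChange K) ((p ^ 1 : ℕ) : ℤ) x F = φx.1 F := by rw [hφx]; rfl
  have hyφ : ∀ d, h1Eval (W.baseChange K) ((p ^ 1 : ℕ) : ℤ) y d = φy.1 d := fun d ↦ by rw [hφy]; rfl
  rw [hPφ, hyφ] at hW₀Q
  rw [hPφ] at hP0
  have hP3 : addOrderOf (φx.1 F) = p := addOrderOf_eq_prime (hpT _) hP0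
  have hxI : ∀ i ∈ (hℓG.place.primeBelow (closureEmb (K := K) (hℓG.place.adicCompletion K)) 𝔐).inertia (absoluteGaloisGroup K),
      φx.1 i = 0 := by
    have h := ((W.baseChange K).oneCocycleClass_mem_selmerLocalKer_iff hgood h3v h𝔓 φx).mp
    rw [hφx, oneCocycleClass_reprCocycle] at h
    rw [hφx]
    exact h hxK
  obtain ⟨fx, hfxdef⟩ : ∃ f : contOneCocycles ((DiscreteGaloisModule.toLocal ((W.baseChange K).torsionGaloisModule ((p ^ 1 : ℕ) : ℤ)) (Sum.inr hℓG.place)).toTopRep),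
      f = contOneCocycles.pullback (absGaloisRestrict K (hℓG.place.adicCompletion K))
        (X := discreteTopRep (absoluteGaloisGroup K) (geomTorsion (W.baseChange K) ((p ^ 1 : ℕ) : ℤ)))
        (Y := (DiscreteGaloisModule.toLocal ((W.baseChange K).torsionGaloisModule ((p ^ 1 : ℕ) : ℤ)) (Sum.inr hℓG.place)).toTopRep)
        (TopRep.ofHom ⟨ContinuousLinearMap.id ℤ (geomTorsion (W.baseChange K) ((p ^ 1 : ℕ) : ℤ)), fun _ => rfl⟩) φx :=
    ⟨_, rfl⟩
  obtain ⟨fy, hfydef⟩ : ∃ f : contOneCocycles ((DiscreteGaloisModule.toLocal ((W.baseChange K).torsionGaloisModule ((p ^ 1 : ℕ) : ℤ)) (Sum.inr hℓG.place)).toTopRep),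
      f = contOneCocycles.pullback (absGaloisRestrict K (hℓG.place.adicCompletion K))
        (X := discreteTopRep (absoluteGaloisGroup K) (geomTorsion (W.baseChange K) ((p ^ 1 : ℕ) : ℤ)))
        (Y := (DiscreteGaloisModule.toLocal ((W.baseChange K).torsionGaloisModule ((p ^ 1 : ℕ) : ℤ)) (Sum.inr hℓG.place)).toTopRep)
        (TopRep.ofHom ⟨ContinuousLinearMap.id ℤ (geomTorsion (W.baseChange K) ((p ^ 1 : ℕ) : ℤ)), fun _ => rfl⟩) φy :=
    ⟨_, rfl⟩
  have hfx : ∀ g, fx.1 g = φx.1 (absGaloisRestrict K (hℓG.place.adicCompletion K) g) := fun g ↦ by rw [hfxdef]; rfl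
  have hfy : ∀ g, fy.1 g = φy.1 (absGaloisRestrict K (hℓG.place.adicCompletion K) g) := fun g ↦ by rw [hfydef]; rfl
  have hlocx : galoisCohomology.localization ((W.baseChange K).torsionGaloisModule ((p ^ 1 : ℕ) : ℤ)) (Sum.inr hℓG.place) 1 x =
      oneCocycleClass ((DiscreteGaloisModule.toLocal ((W.baseChange K).torsionGaloisModule ((p ^ 1 : ℕ) : ℤ)) (Sum.inr hℓG.place)).toTopRep) fx := by
    rw [← oneCocycleClass_reprCocycle (W.baseChange K) ((p ^ 1 : ℕ) : ℤ) x, hfxdef, hφx]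
    exact res_torsionGaloisModule_oneCocycleClass (W.baseChange K) ((p ^ 1 : ℕ) : ℤ) (hℓG.place.adicCompletion K) _
  have hlocy : galoisCohomology.localization ((W.baseChange K).torsionGaloisModule ((p ^ 1 : ℕ) : ℤ)) (Sum.inr hℓG.place) 1 y =
      oneCocycleClass ((DiscreteGaloisModule.toLocal ((W.baseChange K).torsionGaloisModule ((p ^ 1 : ℕ) : ℤ)) (Sum.inr hℓG.place)).toTopRep) fy := by
    rw [← oneCocycleClass_reprCocycle (W.baseChange K) ((p ^ 1 : ℕ) : ℤ) y, hfydef, hφy]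
    exact res_torsionGaloisModule_oneCocycleClass (W.baseChange K) ((p ^ 1 : ℕ) : ℤ) (hℓG.place.adicCompletion K) _
  have hfx_add : ∀ g g', fx.1 (g * g') = fx.1 g + fx.1 g' := fun g g' ↦
    (fx.2 g g').trans (congrArg (fun Q ↦ fx.1 g + Q) (hfixA g (fx.1 g')))
  have hfy_add : ∀ g g', fy.1 (g * g') = fy.1 g + fy.1 g' := fun g g' ↦
    (fy.2 g g').trans (congrArg (fun Q ↦ fy.1 g + Q) (hfixA g (fy.1 g')))
  have hfx1 : fx.1 1 = 0 := by
    have h := hfx_add 1 1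
    rw [mul_one] at h
    exact left_eq_add.mp h
  have hfy1 : fy.1 1 = 0 := by
    have h := hfy_add 1 1
    rw [mul_one] at h
    exact left_eq_add.mp h
  have hfxF : fx.1 gF = φx.1 F := by rw [hfx, hgF]
  -- rank one of `fx`: `fx g = k • (φx.1 F)`
  have hrank : ∀ g, ∃ k : ℕ, fx.1 g = k • (φx.1 F) := by
    intro g
    obtain ⟨k, hk⟩ := KolyLocal.exists_apply_eq_nsmul_apply_of_unramified K hℓG.place h𝔐 fx.1 hfx_add
      (fun g hg ↦ (hfx g).trans (hxI _ hg)) hF hgF g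
    exact ⟨k, hk.trans (congrArg (fun Q ↦ k • Q) hfxF)⟩
  obtain ⟨W₀, hW₀⟩ : ∃ W₀, W₀ = weilPairingHom (W.baseChange K) (p ^ 1) e hμ hadd₁ hadd₂ := ⟨_, rfl⟩
  rw [← hW₀] at hW₀Q
  -- ### local Tate duality: a class `η'` of `H¹(K_λ, E[p]^D)` pairing non-trivially with `loc x`
  have hM : ∀ m : geomTorsion (W.baseChange K) ((p ^ 1 : ℕ) : ℤ), (p ^ 1) • m = 0 := fun m ↦ AddSubgroup.torsionBy.nsmul m
  have hinjL := ((hinvperf hℓG.place).2 ((W.baseChange K).torsionGaloisModule ((p ^ 1 : ℕ) : ℤ)) hM).1.1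
  have hξ0 := mt (mem_torsionLocalKer_iff_localization_eq_zero_P W K p hℓG.place x).mpr hx0
  obtain ⟨η', hη'⟩ : ∃ η', DiscreteGaloisModule.localTatePairingZMod ((W.baseChange K).torsionGaloisModule ((p ^ 1 : ℕ) : ℤ)) (p ^ 1) (Sum.inr hℓG.place)
      (inv (Sum.inr hℓG.place)) (galoisCohomology.localization ((W.baseChange K).torsionGaloisModule ((p ^ 1 : ℕ) : ℤ)) (Sum.inr hℓG.place) 1 x) η' ≠ 0 := by
    by_contra hall
    push Not at hall
    exact hξ0 (hinjL ((AddMonoidHom.ext hall).trans (map_zero _).symm))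
  obtain ⟨g', rfl⟩ := oneCocycleClass_surjective _ η'
  rw [DiscreteGaloisModule.localTatePairingZMod_apply, hlocx, DiscreteGaloisModule.localTatePairing_oneCocycleClass,
    ContPairing.cupClass_eq_twoCocycleClass] at hη'
  -- ### the goal in cocycle currency
  rw [hlocx, hlocy]
  erw [ContPairing.cupProduct_oneCocycleClass]
  rw [ContPairing.cupClass_eq_twoCocycleClass]
  -- ### the characters `n, m : Γ_λ → μ_p`
  let n : C(absoluteGaloisGroup (hℓG.place.adicCompletion K), MuCarrier K (p ^ 1)) :=
    ⟨fun τ ↦ W₀ (φx.1 F) (fy.1 τ), continuous_of_discreteTopology.comp fy.1.continuous⟩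
  let m : C(absoluteGaloisGroup (hℓG.place.adicCompletion K), MuCarrier K (p ^ 1)) :=
    ⟨fun τ ↦ tateDualEval K _ (p ^ 1) (φx.1 F) (g'.1 τ), continuous_of_discreteTopology.comp g'.1.continuous⟩
  have hn : ∀ τ, n τ = W₀ (φx.1 F) (fy.1 τ) := fun _ ↦ rfl
  have hm : ∀ τ, m τ = g'.1 τ (φx.1 F) := fun _ ↦ rfl
  have hn_add : ∀ τ τ', n (τ * τ') = n τ + n τ' := fun τ τ' ↦ by
    rw [hn, hn, hn]
    exact (congrArg (fun Q ↦ W₀ (φx.1 F) Q) (hfy_add τ τ')).trans (map_add _ _ _)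
  have hg'_fix : ∀ (τ : absoluteGaloisGroup (hℓG.place.adicCompletion K)) (f : TateDual K (geomTorsion (W.baseChange K) ((p ^ 1 : ℕ) : ℤ)) (p ^ 1))
      (Q : geomTorsion (W.baseChange K) ((p ^ 1 : ℕ) : ℤ)),
      (((W.baseChange K).torsionGaloisModule ((p ^ 1 : ℕ) : ℤ)).tateDual (p ^ 1)) (absGaloisRestrict K (hℓG.place.adicCompletion K) τ) f Q = f Q := fun τ f Q ↦ by
    rw [DiscreteGaloisModule.tateDual_apply_apply_apply, hfixμ]
    congr 1
    change (absGaloisRestrict K (hℓG.place.adicCompletion K) τ)⁻¹ • Q = Q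
    rw [← map_inv]
    exact hfixA τ⁻¹ Q
  have hm_add : ∀ τ τ', m (τ * τ') = m τ + m τ' := fun τ τ' ↦
    (congrArg (fun f ↦ tateDualEval K _ (p ^ 1) (φx.1 F) f) (g'.2 τ τ')).trans
      ((map_add (tateDualEval K _ (p ^ 1) (φx.1 F)) _ _).trans
        (congrArg (fun t ↦ m τ + t) (hg'_fix τ (g'.1 τ') (φx.1 F))))
  -- the cocycle values
  have hc : ∀ σ τ, ((weilContPairingLocal (W.baseChange K) (p ^ 1) e hμ hadd₁ hadd₂ hgal (Sum.inr hℓG.place)).cupCocycle fx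
      fy).1 (σ, τ) = W₀ (fx.1 σ) (fy.1 τ) := fun σ τ ↦ by
    rw [ContPairing.cupCocycle_apply_eq_smul, weilContPairingLocal_toLin_apply, hW₀]
    exact congrArg (fun Q ↦ weilPairingHom (W.baseChange K) (p ^ 1) e hμ hadd₁ hadd₂ (fx.1 σ) Q) (hfixA σ (fy.1 τ))
  have hc' : ∀ σ τ, ((DiscreteGaloisModule.tateDualPairingLocal ((W.baseChange K).torsionGaloisModule ((p ^ 1 : ℕ) : ℤ))
      (p ^ 1) (Sum.inr hℓG.place)).cupCocycle fx g').1 (σ, τ) = g'.1 τ (fx.1 σ) := fun σ τ ↦ by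
    rw [ContPairing.cupCocycle_apply_eq_smul]
    exact hg'_fix σ (g'.1 τ) (fx.1 σ)
  -- ### `n` is ramified: at a lift `gi` of `i`, `n gi = ẽ((φx.1 F), [y, i]) ≠ 0`
  obtain ⟨gi, hgi⟩ := KolyLocal.exists_absGaloisRestrict_eq_of_mem_decompositionSubgroup K hℓG.place h𝔐
    (Ideal.inertia_le_stabilizer _ hiI)
  have hram : ∃ g, absGaloisRestrict K (hℓG.place.adicCompletion K) g ∈ (hℓG.place.primeBelow (closureEmb (K := K) (hℓG.place.adicCompletion K)) 𝔐).inertia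
      (absoluteGaloisGroup K) ∧ n g ≠ 0 :=
    ⟨gi, by rw [hgi]; exact hiI, fun h0 ↦ hW₀Q ((by rw [hn, hfy, hgi] : n gi = W₀ (φx.1 F) (φy.1 i)).symm.trans h0)⟩
  -- ### the character identity and the rank-one conclusion
  have h3v' : ((p ^ 1 : ℕ) : 𝓞 K) ∉ hℓG.place.asIdeal := by
    have := h3v; rwa [Int.cast_natCast] at this
  obtain ⟨j, w₀, hkey⟩ := exists_sub_zsmul_eq_nsmul_P K hℓG.place p h𝔐 h3v' hℓG.valuation_natCast hF hgF fx.1 hfx_add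
    (fun g hg ↦ (hfx g).trans (hxI _ hg)) ((congrArg addOrderOf hfxF).trans hP3) n m hn_add hm_add hram
  have hc'0 : twoCocycleClass _ ((DiscreteGaloisModule.tateDualPairingLocal
      ((W.baseChange K).torsionGaloisModule ((p ^ 1 : ℕ) : ℤ)) (p ^ 1) (Sum.inr hℓG.place)).cupCocycle fx g') ≠ 0 :=
    fun h0 ↦ hη' (by rw [h0]; exact map_zero _)
  letI : Module (ZMod p) (geomTorsion (W.baseChange K) ((p ^ 1 : ℕ) : ℤ)) := AddCommGroup.zmodModule hpT
  refine twoCocycleClass_ne_zero_of_rank_one_P ((DiscreteGaloisModule.toLocal (mu K (p ^ 1)) (Sum.inr hℓG.place)).toTopRep)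
    fx.1 hfx_add hP3 hrank n m
    ((weilContPairingLocal (W.baseChange K) (p ^ 1) e hμ hadd₁ hadd₂ hgal (Sum.inr hℓG.place)).cupCocycle fx fy)
    ((DiscreteGaloisModule.tateDualPairingLocal ((W.baseChange K).torsionGaloisModule ((p ^ 1 : ℕ) : ℤ)) (p ^ 1)
      (Sum.inr hℓG.place)).cupCocycle fx g')
    (fun σ τ k hk ↦ ?_) (fun σ τ k hk ↦ ?_) hμ3 (fun g ↦ hfixμ g w₀)
    (fun τ k hk ↦ hkey τ k (hk.trans (congrArg (fun Q ↦ k • Q) hfxF.symm))) hp2 hc'0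
  · -- `c(σ, τ) = k_σ · n(τ)`
    rw [hc]
    exact (congrArg (fun Q ↦ W₀ Q (fy.1 τ)) hk).trans (map_nsmul (W₀.flip (fy.1 τ)) k (φx.1 F))
  · -- `c'(σ, τ) = k_σ · m(τ)`
    rw [hc']
    exact (congrArg (fun Q ↦ g'.1 τ Q) hk).trans (map_nsmul (g'.1 τ) k (φx.1 F))


end Summit.BirchSwinnertonDyer.BirchSwinnertonDyer.Theorems.AdditiveKoly

end
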